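import Literature.AlgebraicGeometry.Resolution.EtaleLocalAlgebra
import Literature.AlgebraicGeometry.Resolution.MarkedIdealsArithmetic
import Literature.AlgebraicGeometry.Resolution.BlowupRegularPairCharts
import Literature.AlgebraicGeometry.Resolution.RegularLocalRingsJacobian
import Mathlib.AlgebraicGeometry.IdealSheaf.Functorial
import HarnessLib

/-!
# [OURS · L1 W4.5(b) · EL♮(3) · T23-A″ customer-side bricks (A″-0), (A″-3)] The boundary-witnessed centre `𝓔 ⊔ 𝓕`: ring core and reduced trace
Crux chain w45b, child EL♮(3) = stmt-ResolutionOfSingularities-20148; T23-A″ = the boundary-witnessed round (centre = the transversal intersection of two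
RETAINED members), whose first customer is the typed-residue member x⁴ + y⁶ + z⁶ (res-L1-w45b-lead-1 `ND-SPECIMEN-PASS-2.md` bd97ffa6ab4d5bd9, desk BOOK
2026-08-28T07:38:20Z (iii); sig file `L/res-L1-w45b-lead-1/A2prime-BoundaryWitnessedLift.sig.lean` 007c6321fc326192). This file proves the two
signature-independent pieces of that sig:

* **(A″-0) `isRegularLocalRing_quotient_span_pair_of_quotient_triple`** — in a regular local ring `R`, if `e, f, ϖ ∈ 𝔪` and `R ⧸ (e, f, ϖ)` is regular of
  dimension `dim R − 3`, then `R ⧸ (e, f)` is regular and `ϖ` is a non-zero-divisor on it (`e, f, ϖ` is part of a regular system of parameters —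
  tree `isRsopPart_iff_quotient` — so its sub-family `e, f` is one, `IsRsopPart.comp`, and `ϖ ∉ (e, f)`, `IsRsopPart.not_mem_span_image`, in the
  domain `R ⧸ (e, f)`); this is what makes the upstairs centre `V(𝓔 ⊔ 𝓕)` regular and O-flat at a special point from the downstairs reduced crossing;
* **(A″-3) `comap_sup_eq_vanishingIdeal_inter_of_trace_crossing`** — for two ideal sheaves `𝓔`, `𝓕` with reduced traces `E`, `F` along `jG` and STALKWISE
  reduced crossing `𝓘⟨E⟩_g ⊔ 𝓘⟨F⟩_g = 𝓘⟨E ∩ F⟩_g` at the points of `E ∩ F`, the trace of the sum is the reduced crossing curve: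
  `(𝓔 ⊔ 𝓕).comap jG = 𝓘⟨E ∩ F⟩` (E1 for the A″ centre) — `comap_sup` + ideal sheaves are determined by their stalks; off `E ∩ F` both sides are `⊤`.

* **(A″-0a)/(A″-0b), appended after the self-audit of sig v1** (section `PairCore`): `ringKrullDim_quotient_span_pair_add_two` — in a regular
  local ring a regular quotient `R⧸(e,f)` by a NON-DEGENERATE pair (`(e,f) ≠ (e)`, `(e,f) ≠ (f)`) has dimension `dim R − 2` (what the traces
  SEE: non-tangency of the two members along the special fibre) — and `isRegularLocalRing_quotient_span_triple_of_quotient_pair`, which lifts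
  it across the uniformizer `ϖ` (special fibre regular at the point) to exactly the two hypotheses of (A″-0).

Everything is proved; DEF-FREE; no `sorry`; standard axioms. OURS; NOT a statement of any manuscript; AI-written, weaker than expert review.
`--supports stmt-ResolutionOfSingularities-20148 --as helper`. [cite: Matsumura1987, Thm. 14.2] (index only, through the tree's `IsRsopPart`).
-/

set_option linter.dupNamespace false -- mandated namespace `Summit.<Summit>.<Problem>` of this single-conjunct summit

noncomputable section

open CategoryTheory AlgebraicGeometry TopologicalSpace IsLocalRing
open Literature.AlgebraicGeometry.Resolution
open AlgebraicGeometry.Scheme.IdealSheafData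

namespace Summit.ResolutionOfSingularities.ResolutionOfSingularities.Cruxes.EquisingularLiftNat.Sections

/-! ### (A″-0) the ring core -/

/-- `Set.range ![a, b, c] = {a, b, c}` (the pair case is the tree's `range_vecCons_pair`). [folklore] -/
theorem range_vecCons_triple {R : Type*} (a b c : R) : Set.range ![a, b, c] = ({a, b, c} : Set R) := by
  rw [Matrix.range_cons, range_vecCons_pair, Set.singleton_union]

/-- **(A″-0) RING CORE of the boundary-witnessed centre.** `R` regular local, `e f ϖ ∈ 𝔪`; if `R ⧸ (e, f, ϖ)` is regular of dimension `dim R − 3`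
then `R ⧸ (e, f)` is regular and `ϖ` is a non-zero-divisor on it. [cite: Matsumura1987, Thm. 14.2] -/
theorem isRegularLocalRing_quotient_span_pair_of_quotient_triple {R : Type} [CommRing R] [IsRegularLocalRing R]
    (e f ϖ : R) (he : e ∈ maximalIdeal R) (hf : f ∈ maximalIdeal R) (hϖ : ϖ ∈ maximalIdeal R)
    [IsRegularLocalRing (R ⧸ Ideal.span ({e, f, ϖ} : Set R))]
    (hdim : ringKrullDim (R ⧸ Ideal.span ({e, f, ϖ} : Set R)) + 3 = ringKrullDim R) :
    IsRegularLocalRing (R ⧸ Ideal.span ({e, f} : Set R)) ∧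
      ∀ x : R ⧸ Ideal.span ({e, f} : Set R), Ideal.Quotient.mk _ ϖ * x = 0 → x = 0 := by
  -- `e, f, ϖ` is part of a regular system of parameters
  have h3 : IsRsopPart ![e, f, ϖ] := by
    rw [isRsopPart_iff_quotient, range_vecCons_triple]
    refine ⟨fun i => ?_, inferInstance, by exact_mod_cast hdim⟩
    fin_cases i
    · exact he
    · exact hf
    · exact hϖ
  -- hence so is `e, f`
  have h2 : IsRsopPart ![e, f] := by
    have h := h3.comp (Fin.castSucc (n := 2)) (Fin.castSucc_injective 2)
    have hfun : ![e, f, ϖ] ∘ Fin.castSucc (n := 2) = ![e, f] := by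
      funext i
      fin_cases i <;> rfl
    rwa [hfun] at h
  have hreg : IsRegularLocalRing (R ⧸ Ideal.span ({e, f} : Set R)) := by
    have h := h2.isRegularLocalRing_quotient
    rwa [range_vecCons_pair] at h
  refine ⟨hreg, fun x hx => ?_⟩
  -- `ϖ ∉ (e, f)`, so its class is non-zero in the domain `R ⧸ (e, f)`
  haveI := hreg
  haveI := isDomain_of_isRegularLocalRing (R ⧸ Ideal.span ({e, f} : Set R))
  have hnot : ϖ ∉ Ideal.span ({e, f} : Set R) := by
    have h := h3.not_mem_span_image (S := {0, 1}) (i := 2) (by decide)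
    have himg : (![e, f, ϖ] '' ({0, 1} : Set (Fin 3))) = ({e, f} : Set R) := by
      rw [Set.image_insert_eq, Set.image_singleton]
      rfl
    rwa [himg] at h
  have hne : Ideal.Quotient.mk (Ideal.span ({e, f} : Set R)) ϖ ≠ 0 := by
    rwa [Ne, Ideal.Quotient.eq_zero_iff_mem]
  rcases mul_eq_zero.mp hx with h | h
  · exact absurd h hne
  · exact h

/-! ### (A″-3) the trace of the boundary-witnessed centre -/

universe u

/-- **(A″-3) — the trace of `𝓔 ⊔ 𝓕` is the reduced crossing curve.** For ideal sheaves `𝓔`, `𝓕` on `X` with reduced traces along `jG : G ⟶ X`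
(`𝓔.comap jG = 𝓘⟨E⟩`, `𝓕.comap jG = 𝓘⟨F⟩`) whose traces cross reducedly at every point of `E ∩ F` (stalkwise `𝓘⟨E⟩_g ⊔ 𝓘⟨F⟩_g = 𝓘⟨E ∩ F⟩_g`):
`(𝓔 ⊔ 𝓕).comap jG = 𝓘⟨E ∩ F⟩` — the boundary-witnessed centre has property E1. [folklore] -/
theorem comap_sup_eq_vanishingIdeal_inter_of_trace_crossing {G X : Scheme.{u}} {jG : G ⟶ X} {𝓔 𝓕 : X.IdealSheafData}
    {E F : Set G} {hE : IsClosed E} {hF : IsClosed F}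
    (hE1 : 𝓔.comap jG = vanishingIdeal ⟨E, hE⟩) (hF1 : 𝓕.comap jG = vanishingIdeal ⟨F, hF⟩)
    (hW1 : ∀ g ∈ E ∩ F, stalkIdeal (vanishingIdeal (⟨E, hE⟩ : Closeds G)) g ⊔ stalkIdeal (vanishingIdeal (⟨F, hF⟩ : Closeds G)) g =
      stalkIdeal (vanishingIdeal (⟨E ∩ F, hE.inter hF⟩ : Closeds G)) g) :
    (𝓔 ⊔ 𝓕).comap jG = vanishingIdeal (⟨E ∩ F, hE.inter hF⟩ : Closeds G) := by
  rw [Scheme.IdealSheafData.comap_sup, hE1, hF1]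
  refine ext_of_forall_stalkIdeal_eq fun g => ?_
  rw [stalkIdeal_sup]
  by_cases hg : g ∈ E ∩ F
  · exact hW1 g hg
  · -- off `E ∩ F` both sides are the unit ideal
    have hR : stalkIdeal (vanishingIdeal (⟨E ∩ F, hE.inter hF⟩ : Closeds G)) g = ⊤ :=
      stalkIdeal_eq_top_of_not_mem_support (by rwa [← SetLike.mem_coe, coe_support_vanishingIdeal, Closeds.coe_mk])
    rw [hR, eq_top_iff]
    rcases not_and_or.mp hg with hgE | hgF
    · have h : stalkIdeal (vanishingIdeal (⟨E, hE⟩ : Closeds G)) g = ⊤ :=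
        stalkIdeal_eq_top_of_not_mem_support (by rwa [← SetLike.mem_coe, coe_support_vanishingIdeal, Closeds.coe_mk])
      rw [h, top_sup_eq]
    · have h : stalkIdeal (vanishingIdeal (⟨F, hF⟩ : Closeds G)) g = ⊤ :=
        stalkIdeal_eq_top_of_not_mem_support (by rwa [← SetLike.mem_coe, coe_support_vanishingIdeal, Closeds.coe_mk])
      rw [h, sup_top_eq]

/-! ### (A″-0a) the downstairs half of the ring core: a regular quotient by a NON-DEGENERATE pair drops the dimension by two

Appended 2026-08-28 (res-L1-w45b-lead-1 g12, self-audit of sig 007c6321fc326192): the hypothesis `dim R⧸(e,f,ϖ) + 3 = dim R` of (A″-0)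
is NOT implied by the reduced-crossing trace data (W1)–(W3) of sig v1 — two members tangent along the special fibre (`ℙ³_O`, `𝓔 = (s)`,
`𝓕 = (s − ϖ²u)`: traces `E = F = V(s)`) satisfy (W1)–(W3) while `V(𝓔 ⊔ 𝓕) ⊇ Spec (O⧸ϖ²)[t,v]` is neither regular nor `O`-flat. What the
traces DO see is non-tangency: in the regular local ring `Ā = 𝒪_{G,g}` of the special fibre, the reduced crossing ideal `J = (ē, f̄)` with
`Ā⧸J` regular has `dim Ā⧸J = dim Ā − 2` as soon as `J ≠ (ē)` and `J ≠ (f̄)` — `ringKrullDim_quotient_span_pair_add_two` — and then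
`(e, f, ϖ)` is part of a regular system of parameters upstairs — `isRegularLocalRing_quotient_span_triple_of_quotient_pair`, whose
conclusion is literally the pair of hypotheses of (A″-0). -/

section PairCore

variable {R : Type} [CommRing R]

/-- `span {e, f} = span {e}` as soon as `f ∈ (e)`. [folklore] -/
theorem span_pair_eq_span_singleton_of_mem {e f : R} (h : f ∈ Ideal.span ({e} : Set R)) :
    Ideal.span ({e, f} : Set R) = Ideal.span {e} := by
  refine le_antisymm ?_ (Ideal.span_mono (Set.singleton_subset_iff.mpr (Set.mem_insert e {f})))
  rw [Ideal.span_le]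
  rintro x hx
  rcases hx with rfl | hx
  · exact Ideal.subset_span (Set.mem_singleton x)
  · rw [Set.mem_singleton_iff.mp hx]
    exact h

/-- **One generator outside `𝔪²`.** `R` regular local, `e ∈ 𝔪 ∖ 𝔪²`, `f ∈ 𝔪` with `(e, f) ≠ (e)`: `dim R⧸(e, f) + 2 = dim R`
(`R⧸(e)` is a regular local DOMAIN of dimension `dim R − 1` in which `f̄ ≠ 0`). [cite: Matsumura1987, Thm. 14.2] -/
theorem ringKrullDim_quotient_span_pair_add_two_of_not_mem_sq [IsRegularLocalRing R] {e f : R}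
    (he : e ∈ maximalIdeal R) (he2 : e ∉ maximalIdeal R ^ 2) (hf : f ∈ maximalIdeal R)
    (hJe : Ideal.span ({e, f} : Set R) ≠ Ideal.span {e}) :
    ringKrullDim (R ⧸ Ideal.span ({e, f} : Set R)) + 2 = ringKrullDim R := by
  obtain ⟨hS, hdimS⟩ := IsRegularLocalRing.quotient_span_singleton he he2
  haveI := hS
  haveI := isDomain_of_isRegularLocalRing (R ⧸ Ideal.span ({e} : Set R))
  -- `f̄ ≠ 0` in `R⧸(e)`, and `f̄ ∈ 𝔪`
  have hf0 : Ideal.Quotient.mk (Ideal.span ({e} : Set R)) f ≠ 0 := fun h =>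
    hJe (span_pair_eq_span_singleton_of_mem (Ideal.Quotient.eq_zero_iff_mem.mp h))
  have hfm : Ideal.Quotient.mk (Ideal.span ({e} : Set R)) f ∈ maximalIdeal (R ⧸ Ideal.span ({e} : Set R)) := by
    rw [maximalIdeal_quotient_eq_map (Ideal.span ({e} : Set R))]
    exact Ideal.mem_map_of_mem _ hf
  have hdimT := ringKrullDim_quotient_span_singleton_succ_eq_ringKrullDim_of_mem_nonZeroDivisors
    (mem_nonZeroDivisors_of_ne_zero hf0) hfm
  -- `(R⧸(e))⧸(f̄) ≅ R⧸(e, f)`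
  have eqv : (R ⧸ Ideal.span ({e} : Set R)) ⧸ Ideal.span {Ideal.Quotient.mk (Ideal.span ({e} : Set R)) f} ≃+*
      R ⧸ Ideal.span ({e, f} : Set R) :=
    (Ideal.quotEquivOfEq (by rw [Ideal.map_span, Set.image_singleton])).trans
      ((DoubleQuot.quotQuotEquivQuotSup (Ideal.span ({e} : Set R)) (Ideal.span ({f} : Set R))).trans
        (Ideal.quotEquivOfEq (Ideal.span_insert e ({f} : Set R)).symm))
  rw [← ringKrullDim_eq_of_ringEquiv eqv, ← hdimS, ← hdimT, add_assoc, one_add_one_eq_two]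

/-- **(A″-0a) — a regular quotient by a non-degenerate pair drops the dimension by two.** `R` regular local, `e f ∈ 𝔪` with
`R⧸(e, f)` regular and `(e, f) ≠ (e)`, `(e, f) ≠ (f)` (the pair is not generated by one of its members): `dim R⧸(e, f) + 2 = dim R`.
If one of `e, f` lies outside `𝔪²` this is the previous lemma; if both lie in `𝔪²` then `emb dim R⧸(e,f) = emb dim R = dim R >
dim R⧸(e,f)` contradicts regularity. [cite: Matsumura1987, Thm. 14.2] -/
theorem ringKrullDim_quotient_span_pair_add_two [IsRegularLocalRing R] {e f : R}
    (he : e ∈ maximalIdeal R) (hf : f ∈ maximalIdeal R)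
    [hJ : IsRegularLocalRing (R ⧸ Ideal.span ({e, f} : Set R))]
    (hJe : Ideal.span ({e, f} : Set R) ≠ Ideal.span {e}) (hJf : Ideal.span ({e, f} : Set R) ≠ Ideal.span {f}) :
    ringKrullDim (R ⧸ Ideal.span ({e, f} : Set R)) + 2 = ringKrullDim R := by
  by_cases he2 : e ∈ maximalIdeal R ^ 2
  swap
  · exact ringKrullDim_quotient_span_pair_add_two_of_not_mem_sq he he2 hf hJe
  by_cases hf2 : f ∈ maximalIdeal R ^ 2
  swap
  · have h := ringKrullDim_quotient_span_pair_add_two_of_not_mem_sq hf hf2 he (by rwa [Set.pair_comm])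
    rwa [Set.pair_comm] at h
  exfalso
  -- both generators in `𝔪²`
  haveI := isDomain_of_isRegularLocalRing R
  have he0 : e ≠ 0 := by
    rintro rfl
    exact hJf (by rw [Ideal.span_insert_zero])
  -- `S = R⧸(e)`: local, `emb dim R ≤ emb dim S`, `dim S + 1 = dim R`
  haveI : Nontrivial (R ⧸ Ideal.span ({e} : Set R)) :=
    Ideal.Quotient.nontrivial_iff.mpr (Ideal.span_singleton_ne_top he)
  haveI : IsLocalRing (R ⧸ Ideal.span ({e} : Set R)) := isLocalRing_quotient (Ideal.span_singleton_ne_top he)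
  have h1 := spanFinrank_maximalIdeal_le_spanFinrank_map_of_mem_sq he2
  rw [← maximalIdeal_quotient_eq_map (Ideal.span ({e} : Set R))] at h1
  have hdimS := ringKrullDim_quotient_span_singleton_succ_eq_ringKrullDim_of_mem_nonZeroDivisors
    (mem_nonZeroDivisors_of_ne_zero he0) he
  -- `f̄ ∈ 𝔪_S²`; `T = S⧸(f̄)`: local, `emb dim S ≤ emb dim T`, `dim T ≤ dim S`
  have hfm : Ideal.Quotient.mk (Ideal.span ({e} : Set R)) f ∈ maximalIdeal (R ⧸ Ideal.span ({e} : Set R)) := by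
    rw [maximalIdeal_quotient_eq_map (Ideal.span ({e} : Set R))]
    exact Ideal.mem_map_of_mem _ hf
  have hf2' : Ideal.Quotient.mk (Ideal.span ({e} : Set R)) f ∈ maximalIdeal (R ⧸ Ideal.span ({e} : Set R)) ^ 2 := by
    rw [maximalIdeal_quotient_eq_map (Ideal.span ({e} : Set R)), ← Ideal.map_pow]
    exact Ideal.mem_map_of_mem _ hf2
  haveI : Nontrivial ((R ⧸ Ideal.span ({e} : Set R)) ⧸ Ideal.span {Ideal.Quotient.mk (Ideal.span ({e} : Set R)) f}) :=
    Ideal.Quotient.nontrivial_iff.mpr (Ideal.span_singleton_ne_top hfm)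
  haveI : IsLocalRing ((R ⧸ Ideal.span ({e} : Set R)) ⧸ Ideal.span {Ideal.Quotient.mk (Ideal.span ({e} : Set R)) f}) :=
    isLocalRing_quotient (Ideal.span_singleton_ne_top hfm)
  have h2 := spanFinrank_maximalIdeal_le_spanFinrank_map_of_mem_sq hf2'
  rw [← maximalIdeal_quotient_eq_map (Ideal.span {Ideal.Quotient.mk (Ideal.span ({e} : Set R)) f})] at h2
  have hTS := ringKrullDim_quotient_le (Ideal.span {Ideal.Quotient.mk (Ideal.span ({e} : Set R)) f})
  -- `T ≅ R⧸(e, f)` is regular: `emb dim T = dim T`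
  have eqv : (R ⧸ Ideal.span ({e} : Set R)) ⧸ Ideal.span {Ideal.Quotient.mk (Ideal.span ({e} : Set R)) f} ≃+*
      R ⧸ Ideal.span ({e, f} : Set R) :=
    (Ideal.quotEquivOfEq (by rw [Ideal.map_span, Set.image_singleton])).trans
      ((DoubleQuot.quotQuotEquivQuotSup (Ideal.span ({e} : Set R)) (Ideal.span ({f} : Set R))).trans
        (Ideal.quotEquivOfEq (Ideal.span_insert e ({f} : Set R)).symm))
  haveI hT : IsRegularLocalRing
      ((R ⧸ Ideal.span ({e} : Set R)) ⧸ Ideal.span {Ideal.Quotient.mk (Ideal.span ({e} : Set R)) f}) :=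
    IsRegularLocalRing.of_ringEquiv eqv.symm
  have hTreg := (isRegularLocalRing_iff _).mp hT
  have hRreg := (isRegularLocalRing_iff R).mp ‹_›
  -- numerics
  obtain ⟨d, hd⟩ := exists_nat_cast_eq_ringKrullDim (R := R)
  obtain ⟨s, hs⟩ := exists_nat_cast_eq_ringKrullDim (R := R ⧸ Ideal.span ({e} : Set R))
  obtain ⟨t, ht⟩ := exists_nat_cast_eq_ringKrullDim
    (R := (R ⧸ Ideal.span ({e} : Set R)) ⧸ Ideal.span {Ideal.Quotient.mk (Ideal.span ({e} : Set R)) f})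
  rw [hd] at hRreg hdimS
  rw [hs] at hdimS hTS
  rw [ht] at hTreg hTS
  have e1 : (maximalIdeal R).spanFinrank = d := by exact_mod_cast hRreg
  have e2 : (maximalIdeal ((R ⧸ Ideal.span ({e} : Set R)) ⧸
      Ideal.span {Ideal.Quotient.mk (Ideal.span ({e} : Set R)) f})).spanFinrank = t := by exact_mod_cast hTreg
  have e3 : s + 1 = d := by exact_mod_cast hdimS
  have e4 : t ≤ s := by exact_mod_cast hTS
  omega

/-- **(A″-0a′) — the same, as a part of a regular system of parameters.** [cite: Matsumura1987, Thm. 14.2] -/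
theorem isRsopPart_pair_of_isRegularLocalRing_quotient [IsRegularLocalRing R] {e f : R}
    (he : e ∈ maximalIdeal R) (hf : f ∈ maximalIdeal R)
    [IsRegularLocalRing (R ⧸ Ideal.span ({e, f} : Set R))]
    (hJe : Ideal.span ({e, f} : Set R) ≠ Ideal.span {e}) (hJf : Ideal.span ({e, f} : Set R) ≠ Ideal.span {f}) :
    IsRsopPart ![e, f] := by
  rw [isRsopPart_iff_quotient, range_vecCons_pair]
  refine ⟨fun i => ?_, ‹_›, by exact_mod_cast ringKrullDim_quotient_span_pair_add_two he hf hJe hJf⟩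
  fin_cases i
  · exact he
  · exact hf

/-- **(A″-0b) — lifting the pair across the uniformizer: the hypotheses of (A″-0).** `A` regular local, `ϖ ∈ 𝔪 ∖ 0` with `Ā = A⧸(ϖ)`
regular (the special fibre is regular at the point), `e f ∈ 𝔪`; if `Ā⧸(ē, f̄)` is regular and `(ē, f̄) ≠ (ē)`, `(ē, f̄) ≠ (f̄)` in `Ā`,
then `A⧸(e, f, ϖ)` is regular and `dim A⧸(e, f, ϖ) + 3 = dim A`. [cite: Matsumura1987, Thm. 14.2] -/
theorem isRegularLocalRing_quotient_span_triple_of_quotient_pair {A : Type} [CommRing A] [IsRegularLocalRing A]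
    (e f ϖ : A) (he : e ∈ maximalIdeal A) (hf : f ∈ maximalIdeal A) (hϖ : ϖ ∈ maximalIdeal A) (hϖ0 : ϖ ≠ 0)
    [IsRegularLocalRing (A ⧸ Ideal.span ({ϖ} : Set A))]
    [IsRegularLocalRing ((A ⧸ Ideal.span ({ϖ} : Set A)) ⧸
      Ideal.span ({Ideal.Quotient.mk (Ideal.span ({ϖ} : Set A)) e, Ideal.Quotient.mk (Ideal.span ({ϖ} : Set A)) f} :
        Set (A ⧸ Ideal.span ({ϖ} : Set A))))]
    (hJe : Ideal.span ({Ideal.Quotient.mk (Ideal.span ({ϖ} : Set A)) e, Ideal.Quotient.mk (Ideal.span ({ϖ} : Set A)) f} :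
        Set (A ⧸ Ideal.span ({ϖ} : Set A))) ≠ Ideal.span {Ideal.Quotient.mk (Ideal.span ({ϖ} : Set A)) e})
    (hJf : Ideal.span ({Ideal.Quotient.mk (Ideal.span ({ϖ} : Set A)) e, Ideal.Quotient.mk (Ideal.span ({ϖ} : Set A)) f} :
        Set (A ⧸ Ideal.span ({ϖ} : Set A))) ≠ Ideal.span {Ideal.Quotient.mk (Ideal.span ({ϖ} : Set A)) f}) :
    IsRegularLocalRing (A ⧸ Ideal.span ({e, f, ϖ} : Set A)) ∧
      ringKrullDim (A ⧸ Ideal.span ({e, f, ϖ} : Set A)) + 3 = ringKrullDim A := by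
  haveI := isDomain_of_isRegularLocalRing A
  have hem : Ideal.Quotient.mk (Ideal.span ({ϖ} : Set A)) e ∈ maximalIdeal (A ⧸ Ideal.span ({ϖ} : Set A)) := by
    rw [maximalIdeal_quotient_eq_map (Ideal.span ({ϖ} : Set A))]
    exact Ideal.mem_map_of_mem _ he
  have hfm : Ideal.Quotient.mk (Ideal.span ({ϖ} : Set A)) f ∈ maximalIdeal (A ⧸ Ideal.span ({ϖ} : Set A)) := by
    rw [maximalIdeal_quotient_eq_map (Ideal.span ({ϖ} : Set A))]
    exact Ideal.mem_map_of_mem _ hf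
  have hpair := ringKrullDim_quotient_span_pair_add_two hem hfm hJe hJf
  have hdimA := ringKrullDim_quotient_span_singleton_succ_eq_ringKrullDim_of_mem_nonZeroDivisors
    (mem_nonZeroDivisors_of_ne_zero hϖ0) hϖ
  -- `Ā⧸(ē, f̄) ≅ A⧸(e, f, ϖ)`
  have himg : (Ideal.span ({e, f} : Set A)).map (Ideal.Quotient.mk (Ideal.span ({ϖ} : Set A))) =
      Ideal.span {Ideal.Quotient.mk (Ideal.span ({ϖ} : Set A)) e, Ideal.Quotient.mk (Ideal.span ({ϖ} : Set A)) f} := by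
    rw [Ideal.map_span, Set.image_insert_eq, Set.image_singleton]
  have hsup : Ideal.span ({ϖ} : Set A) ⊔ Ideal.span ({e, f} : Set A) = Ideal.span ({e, f, ϖ} : Set A) := by
    rw [← Ideal.span_union, Set.singleton_union, Set.insert_comm ϖ e, Set.pair_comm ϖ f]
  have eqv : (A ⧸ Ideal.span ({ϖ} : Set A)) ⧸
      Ideal.span ({Ideal.Quotient.mk (Ideal.span ({ϖ} : Set A)) e, Ideal.Quotient.mk (Ideal.span ({ϖ} : Set A)) f} :
        Set (A ⧸ Ideal.span ({ϖ} : Set A))) ≃+* A ⧸ Ideal.span ({e, f, ϖ} : Set A) :=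
    (Ideal.quotEquivOfEq himg.symm).trans
      ((DoubleQuot.quotQuotEquivQuotSup (Ideal.span ({ϖ} : Set A)) (Ideal.span ({e, f} : Set A))).trans
        (Ideal.quotEquivOfEq hsup))
  refine ⟨IsRegularLocalRing.of_ringEquiv eqv, ?_⟩
  rw [← ringKrullDim_eq_of_ringEquiv eqv, ← hdimA, ← hpair, add_assoc]
  norm_num

end PairCore

end Summit.ResolutionOfSingularities.ResolutionOfSingularities.Cruxes.EquisingularLiftNat.Sections

end
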